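import Literature.Computability.AlgebraicComplexity.PlethysmTableauEvaluation
import HarnessLib

/-!
# Label-major evaluation of tableau highest-weight vectors: the walk of one label (specification)

Topic `Computability/AlgebraicComplexity`; an EXECUTABLE definitions file for the Lean certificate
checker of the GCT multiplicity-obstruction engine (cell `pub-gct`; honest framing of that cell:
rung-1 multiplicity-obstruction search for permanent versus determinant at small `(n, m)`; no
claim about VP ≠ VNP or P ≠ NP is made here or there).

`TableauEval.evalC` (`PlethysmTableauEvaluation.lean`) evaluates a tableau network column by column
(`∏_c h_c!` signed tuples of column bijections). The SAME number can be organised label by label —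
the transfer-matrix organisation of the proper-placement sum of [DorflerIkenmeyerPanova2020, §5,
after "we observe that"], there run over columns, here over labels: for a COLUMN-STRICT filling
(labels strictly increasing down every column, as in every semistandard tableau) the boxes labelled
`u` are the topmost unassigned boxes of the columns containing `u`, so processing the labels in
increasing order and giving each such box one of the still unused alternator variables of its
column — the `j`-th unused one with the sign `(-1)^j`, the row expansion of the column's
alternator — enumerates every tuple of column bijections exactly once with its sign, and all that
has to be remembered between two labels is the list of RESIDUAL columns (unused variables,
remaining labels).

This file holds the specification level of that organisation: §1 residual columns and the walk
`walkL` of one label; §2 `specL`, the label-major recursion without any merging or pruning (for a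
column-strict network passing its structural check it equals `evalC` — proofs file
`TableauEvalLabelMajorSpec.lean`); §3 the column-strictness check; §4 a kernel sanity value. The
kernel-efficient programme built on it (merging equal residual states, pruning dead words) is
`TableauEvalLabelMajor.lean`. Elementary [folklore] bookkeeping around the cited formula; no
statement about representations is made here.

## References
* [DorflerIkenmeyerPanova2020] J. Dörfler, C. Ikenmeyer, G. Panova, *On geometric complexity
  theory: multiplicity obstructions are stronger than occurrence obstructions*, SIAM J. Appl.
  Algebra Geom. 4 (2020) = arXiv:1901.04576, §5.
-/

namespace Literature.Computability.AlgebraicComplexity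

namespace TableauEval

/-! ## §1 Residual columns and the walk of one label -/

/-- A column is ACTIVE at label `u` when its topmost remaining box carries `u`. [folklore] -/
def Column.active (c : Column) (u : ℕ) : Bool := c.labels.head? == some u

/-- The residual column after its topmost box received the `j`-th of its unused variables: that
variable and the top label are erased. [folklore] -/
def Column.reduce (c : Column) (j : ℕ) : Column := ⟨c.vars.eraseIdx j, c.labels.tail⟩

/-- **The walk of label `u` through a list of residual columns**: every active column gives its
top box one of its unused variables (index `j`; the parity of `j` is accumulated), inactive
columns are kept; outcomes `(parity, word of label u in column order, residual columns)`.
[folklore] -/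
def walkL (u : ℕ) : List Column → List (Bool × List ℕ × List Column)
  | [] => [(false, [], [])]
  | c :: cs =>
    if c.active u then
      (List.range c.vars.length).flatMap fun j =>
        (walkL u cs).map fun t =>
          (xor (decide (j % 2 = 1)) t.1, c.vars.getD j 0 :: t.2.1, c.reduce j :: t.2.2)
    else (walkL u cs).map fun t => (t.1, t.2.1, c :: t.2.2)

/-! ## §2 The specification -/

section Spec

variable {R : Type*} [CommRing R]

/-- **Label-major evaluation, specification form**: process the labels in the given order; every
outcome of a walk contributes sign × `S (word)` × the value of the residual columns on the
remaining labels. For a column-strict network passing its structural check and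
`S = symEntry P` (on words of the right length) this is `evalC P N` (proofs file). [folklore] -/
def specL (S : List ℕ → R) : List ℕ → List Column → R
  | [], _ => 1
  | u :: us, cs => ((walkL u cs).map fun t => sgn t.1 * S t.2.1 * specL S us t.2.2).sum

end Spec

/-! ## §3 Column-strictness -/

/-- A list of naturals is strictly increasing. [folklore] -/
def strictAsc : List ℕ → Bool
  | [] => true
  | [_] => true
  | a :: b :: l => a < b && strictAsc (b :: l)

/-- Every column's labels increase strictly from top to bottom (true for semistandard tableaux).
[folklore] -/
def Network.columnStrict (N : Network) : Bool := N.cols.all fun c => strictAsc c.labels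

/-! ## §4 Sanity value (kernel) -/

/-- On the toy network `1 1 / 2 2` at `2 x₀ x₁` presented as two products, `specL = evalC = -8`.
[folklore] -/
example :
    let P : Point ℤ := ⟨[(1, [[1, 0], [0, 1]]), (1, [[0, 1], [1, 0]])]⟩
    let N : Network := ⟨2, 2, [⟨[0, 1], [0, 1]⟩, ⟨[0, 1], [0, 1]⟩]⟩
    specL (symEntry P) [0, 1] N.cols = -8 ∧ evalC P N = -8 ∧ N.columnStrict = true := by
  decide +kernel

end TableauEval

end Literature.Computability.AlgebraicComplexity
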